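import Summits.QuantumFields.YangMills.Theorems.BalabanUVNodesN07RecordLettersReality
import HarnessLib

/-!
# NODE N07 — SECT. C's `H♭ = G₁Q*(QG₁Q*)⁻¹` OF RECORD IS REAL: `Δ_{1,a}(U₀)`, `G₁`, `(QG₁Q†)⁻¹`, `H₁` COMMUTE WITH `⋆` AT EVERY GUARDED `SU(N)` BACKGROUND, and def-Y's
# (115)-typed letter `H1OfRecordAtBgFlat` maps the conjugate block field `Bᴴ` to the conjugate jet `(H♭B)ᴴ` ([B9] p. 392 «hermitian operator», [15] (45)∕(103))

Cell `pub-ymgap`, width seat `pub-ymgap-dag-n07-w3` (g26), CLAIM-3.  `--kind proof --supports stmt-QuantumFields-27238 --as helper`; count-neutral.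
[B9] = [Balaban1985BackgroundPropagators]; [15] = [Balaban1985Variational].

WHY.  Second file of the reality programme for THE (3.134) datum `Δ2` (✓`N07RecordLettersReality`: `Δ(U₀)`, `D`, `D*`, `Q′♭`, `R`, `Q(U₀)` real).  The right
side of (3.134) is `−2⟨J(U₀), H♭(C⁽²⁾A)⟩` with Sect. C's `H♭ = H1OfRecordAtBgFlat` = lit's (L6) letter `H₁ = G₁Q†(QG₁Q†)⁻¹` read in the type of (115); here that
letter is proved REAL at every guarded background: every ingredient of `Δ_{1,a}(U₀; Δ₁) = Δ₁ + DRD* + aQ†Q` is real (file 1), Green operators and adjoints of real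
operators are real (lit ✓`real_greenK`, ✓`real_adjoint`), and the (115) reading is conjugation by the fibre identification `φ = phiRec N`.
* §1 ★`laplaceAOfRecordAt_starW` (any REAL Hessian slot `Δ₁`), `laplaceAOfRecord_starW` (bare slot), `adjoint_QOfRecord_starW` (`Q(U₀)†` real).
* §2 ★`G1LatticeK_ofRecord_starW` (`G₁ = Δ_{1,a}⁻¹`), ★`KinvLatticeK_ofRecord_starW` (`(QG₁Q†)⁻¹`), ★★`H1LatticeK_ofRecord_starW` (`H₁ = G₁Q†(QG₁Q†)⁻¹`).
* §3 the (115) reading: `funEquiv_symm_star`, ★★★`equiv_H1OfRecordAt_star` — for every REAL slot `Δ₁`: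
  `(H₁(U₀; Δ₁) Bᴴ)(b) = ((H₁(U₀; Δ₁) B)(b))ᴴ`, `Bᴴ` the bondwise conjugate block field; ★★★`equiv_H1OfRecordAtBgFlat_star` (Sect. C's `H♭`, `Δ₁ := Δ(U₀)`).

HONEST LABELS.  `*`-algebra bookkeeping (anti-unitary involution; inverses ∕ adjoints ∕ compositions of real operators); NO estimate; modulo the displayed `hpos`
([B9] Thm 3.11∕3.12) and `hQ` that the letters themselves carry, and 35b's guard for `Q(U₀)`.  `C^{𝔰𝔩}`, `𝔊`, the slot-(c) Hessian and the (3.134) assembly are the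
sequel files.  Count-neutral; N07 NOT discharged; P0 ⟨26900⟩ OPEN; R4 is the conditional finite-𝕋⁴ rung only.  Nothing here is a claim about the Yang–Mills mass
gap (`Summit.QuantumFields`): finite torus, fixed `ε`; nothing continuum ∕ OS ∕ Clay.
-/

set_option autoImplicit false

noncomputable section

open scoped Matrix Matrix.Norms.L2Operator InnerProductSpace ComplexConjugate BigOperators

namespace Summit.QuantumFields.YangMills.Theorems.N07H1OfRecordReality

open Literature.MathematicalPhysics.QuantumFieldTheory.Balaban1983to89
open Literature.MathematicalPhysics.QuantumFieldTheory.Balaban1983to89.T4Continuum (T4Family)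
open T4Continuum BlockAveraging
open B4Sect5Torus (TSite)
open B9SectCLatticeCarrier (Bond)
open B9Eq311L2Pairing (WL2)
open B9Eq311TracePairing (starW equiv_starW apply_equiv_starW starW_starW)
open B11Eq103H1Complex (SiteL2K BondL2K covDerivL2K covDivL2K laplaceALatticeK laplaceAK greenK G1K G1LatticeK KinvK KinvLatticeK H1K H1LatticeK
  H1LatticeK_eq funEquiv funEquiv_symm_apply H1LatticeCLM H1CLM H1CLM_apply)
open B11Eq115Space (NegSup NegSize levWeight JetSup)
open B11Eq111FrakG (nabla115)
open B9Eq3119DeltaPiReality (real_comp real_add real_smul_ofReal real_adjoint real_greenK)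
open Node00
open Summit.QuantumFields.YangMills.Theorems.N07HessOpOfRecordSymmetric (tauRec_star tauRec_mul_comm)
open Summit.QuantumFields.YangMills.Theorems.N07RecordLettersReality (hessOpOfRecord_starW covDerivL2K_ofRecord_starW covDivL2K_ofRecord_starW
  RrOfRecord_QflatOfRecord_starW QOfRecord_starW)

variable (F : T4Family) (N : ℕ) [NeZero N] {K : ℕ} (k : ℕ) (U₀ : GaugeField (F.P K) 0 (SU N)) [Fact (0 < c0Rec F K k)]
  [Fact (∀ c, 0 < wBRec F K k c)]

/-! ## §1  (110)'s `Δ_{1,a}(U₀; Δ₁)` and `Q(U₀)†` are real -/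

/-- `Q(U₀)†` is real under the guard (anti-unitary `⋆` on both sides; lit ✓`real_adjoint`). [cite: Balaban1985BackgroundPropagators, (3.24) p.394; Balaban1985Variational, (103) p.293] -/
theorem adjoint_QOfRecord_starW (h : SmallBelow (avOfRecord F N K) k U₀) (g : WL2 ℂ (wBRec F K k) (WRec N)) :
    LinearMap.adjoint (QOfRecord F N k U₀) (starW (phiRec N) g) = starW (phiRec N) (LinearMap.adjoint (QOfRecord F N k U₀) g) :=
  real_adjoint (phiRec N) (tauRec N) inner_phiRec_symm (tauRec_star N) (tauRec_mul_comm N) (QOfRecord_starW F N k U₀ h) g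

/-- ★ **`Δ_{1,a}(U₀; Δ₁) = Δ₁ + DRD* + aQ†Q` IS REAL FOR EVERY REAL HESSIAN SLOT `Δ₁`** at the letters `(Q(U₀), Q′♭)`, under the guard.
[cite: Balaban1985Variational, (110) p.294; Balaban1985BackgroundPropagators, (3.26) p.395, p.392] -/
theorem laplaceAOfRecordAt_starW (h : SmallBelow (avOfRecord F N K) k U₀)
    {Δ₁ : BondL2K ℂ (F.P K).d (fun _ => (F.P K).sitesPerDir 0) (c0Rec F K k) (WRec N) →ₗ[ℂ]
      BondL2K ℂ (F.P K).d (fun _ => (F.P K).sitesPerDir 0) (c0Rec F K k) (WRec N)}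
    (hΔ₁ : ∀ x, Δ₁ (starW (phiRec N) x) = starW (phiRec N) (Δ₁ x)) (a : ℝ)
    (x : BondL2K ℂ (F.P K).d (fun _ => (F.P K).sitesPerDir 0) (c0Rec F K k) (WRec N)) :
    laplaceAOfRecordAt F N k U₀ Δ₁ (QOfRecord F N k U₀) (QflatOfRecord F N k) a (starW (phiRec N) x) =
      starW (phiRec N) (laplaceAOfRecordAt F N k U₀ Δ₁ (QOfRecord F N k U₀) (QflatOfRecord F N k) a x) := by
  unfold laplaceAOfRecordAt laplaceALatticeK laplaceAK
  exact real_add (phiRec N)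
    (real_add (phiRec N) hΔ₁ (real_comp (phiRec N) (covDerivL2K_ofRecord_starW F N k U₀)
      (real_comp (phiRec N) (RrOfRecord_QflatOfRecord_starW F N k U₀) (covDivL2K_ofRecord_starW F N k U₀))))
    (real_comp (phiRec N) (adjoint_QOfRecord_starW F N k U₀ h) (real_smul_ofReal (phiRec N) (QOfRecord_starW F N k U₀ h) a)) x

/-- **`Δ_{1,a}(U₀)` AT THE BARE SLOT `Δ₁ := Δ(U₀)` IS REAL** under the guard. [cite: Balaban1985Variational, (110) p.294; Balaban1985BackgroundPropagators, (3.26) p.395] -/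
theorem laplaceAOfRecord_starW (h : SmallBelow (avOfRecord F N K) k U₀) (a : ℝ)
    (x : BondL2K ℂ (F.P K).d (fun _ => (F.P K).sitesPerDir 0) (c0Rec F K k) (WRec N)) :
    laplaceAOfRecord F N k U₀ (QOfRecord F N k U₀) (QflatOfRecord F N k) a (starW (phiRec N) x) =
      starW (phiRec N) (laplaceAOfRecord F N k U₀ (QOfRecord F N k U₀) (QflatOfRecord F N k) a x) :=
  laplaceAOfRecordAt_starW F N k U₀ h (hessOpOfRecord_starW F N k U₀) a x

/-! ## §2  `G₁`, `(QG₁Q†)⁻¹`, `H₁ = G₁Q†(QG₁Q†)⁻¹` are real -/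

section Green

variable {Δ₁ : BondL2K ℂ (F.P K).d (fun _ => (F.P K).sitesPerDir 0) (c0Rec F K k) (WRec N) →ₗ[ℂ]
    BondL2K ℂ (F.P K).d (fun _ => (F.P K).sitesPerDir 0) (c0Rec F K k) (WRec N)} {a : ℝ}
  (hpos : ∀ x, x ≠ 0 → 0 < RCLike.re ⟪x, laplaceAOfRecordAt F N k U₀ Δ₁ (QOfRecord F N k U₀) (QflatOfRecord F N k) a x⟫_ℂ)

/-- ★ **`G₁ = Δ_{1,a}(U₀; Δ₁)⁻¹` IS REAL** (real slot `Δ₁`, guard; lit ✓`real_greenK`). [cite: Balaban1985Variational, (110) p.294; Balaban1985BackgroundPropagators, Thm 3.11 p.416] -/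
theorem G1LatticeK_ofRecord_starW (h : SmallBelow (avOfRecord F N K) k U₀) (hΔ₁ : ∀ x, Δ₁ (starW (phiRec N) x) = starW (phiRec N) (Δ₁ x))
    (x : BondL2K ℂ (F.P K).d (fun _ => (F.P K).sitesPerDir 0) (c0Rec F K k) (WRec N)) :
    G1LatticeK hpos (starW (phiRec N) x) = starW (phiRec N) (G1LatticeK hpos x) := by
  unfold G1LatticeK G1K
  exact real_greenK (phiRec N) hpos (laplaceAOfRecordAt_starW F N k U₀ h hΔ₁ a) x

/-- ★ **`(QG₁Q†)⁻¹` IS REAL** (lit ✓`real_greenK` on the real `QG₁Q†`). [cite: Balaban1985Variational, (45) p.285, (103) p.293] -/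
theorem KinvLatticeK_ofRecord_starW (h : SmallBelow (avOfRecord F N K) k U₀) (hΔ₁ : ∀ x, Δ₁ (starW (phiRec N) x) = starW (phiRec N) (Δ₁ x))
    (hQ : Function.Surjective (QOfRecord F N k U₀)) (g : WL2 ℂ (wBRec F K k) (WRec N)) :
    KinvLatticeK hpos hQ (starW (phiRec N) g) = starW (phiRec N) (KinvLatticeK hpos hQ g) := by
  unfold KinvLatticeK KinvK
  exact real_greenK (phiRec N) _
    (real_comp (phiRec N) (QOfRecord_starW F N k U₀ h)
      (real_comp (phiRec N) (G1LatticeK_ofRecord_starW F N k U₀ hpos h hΔ₁) (adjoint_QOfRecord_starW F N k U₀ h))) g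

/-- ★★ **`H₁ = G₁Q†(QG₁Q†)⁻¹` OF (45)∕(103) IS REAL AT THE HILBERT LEVEL.** [cite: Balaban1985Variational, (45) p.285, (103) p.293] -/
theorem H1LatticeK_ofRecord_starW (h : SmallBelow (avOfRecord F N K) k U₀) (hΔ₁ : ∀ x, Δ₁ (starW (phiRec N) x) = starW (phiRec N) (Δ₁ x))
    (hQ : Function.Surjective (QOfRecord F N k U₀)) (g : WL2 ℂ (wBRec F K k) (WRec N)) :
    H1LatticeK hpos hQ (starW (phiRec N) g) = starW (phiRec N) (H1LatticeK hpos hQ g) := by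
  rw [H1LatticeK_eq]
  exact real_comp (phiRec N) (G1LatticeK_ofRecord_starW F N k U₀ hpos h hΔ₁)
    (real_comp (phiRec N) (adjoint_QOfRecord_starW F N k U₀ h) (KinvLatticeK_ofRecord_starW F N k U₀ hpos h hΔ₁ hQ)) g

end Green

/-! ## §3  The (115) reading: `H₁(U₀; Δ₁)` and Sect. C's `H♭` map `Bᴴ` to `(H B)ᴴ` -/

section Reading

variable [Fact (0 < (F.L : ℝ))] [Fact (0 < (F.P K).eta k)] (Ω : ℕ → Set (Site (F.P K) 0))

omit [NeZero N] [Fact (∀ c, 0 < wBRec F K k c)] [Fact (0 < (F.L : ℝ))] [Fact (0 < (F.P K).eta k)] in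
/-- Reading a conjugate block field into the Hilbert carrier gives the conjugate vector: `φ⁻¹ ∘ gᴴ = (φ⁻¹ ∘ g)⋆`. [cite: Balaban1985Averaging, (18)–(19) p.21 (bookkeeping)] -/
theorem funEquiv_symm_star {β : Type*} (wB : β → ℝ) (g : β → Matrix (Fin N) (Fin N) ℂ) :
    (funEquiv (phiRec N) wB).symm (star g) = starW (phiRec N) ((funEquiv (phiRec N) wB).symm g) := by
  apply (WL2.equiv ℂ wB (WRec N)).injective
  funext c
  rw [funEquiv_symm_apply, equiv_starW, funEquiv_symm_apply, LinearEquiv.apply_symm_apply, Pi.star_apply]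

variable {Δ₁ : BondL2K ℂ (F.P K).d (fun _ => (F.P K).sitesPerDir 0) (c0Rec F K k) (WRec N) →ₗ[ℂ]
    BondL2K ℂ (F.P K).d (fun _ => (F.P K).sitesPerDir 0) (c0Rec F K k) (WRec N)} {a : ℝ}
  (hpos : ∀ x, x ≠ 0 → 0 < RCLike.re ⟪x, laplaceAOfRecordAt F N k U₀ Δ₁ (QOfRecord F N k U₀) (QflatOfRecord F N k) a x⟫_ℂ)

/-- ★★★ **`H₁(U₀; Δ₁)` OF RECORD IN THE TYPE OF (115) IS REAL**: for every real Hessian slot `Δ₁`, under the guard, the jet `H₁(U₀; Δ₁)Bᴴ` of the bondwise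
conjugate block field is the bondwise conjugate of the jet `H₁(U₀; Δ₁)B` (`levB` arbitrary). [cite: Balaban1985Variational, (45) p.285, (103) p.293, (115) p.294; Balaban1985BackgroundPropagators, p.392] -/
theorem equiv_H1OfRecordAt_star (levB : PBond (F.P K) k → ℕ) (h : SmallBelow (avOfRecord F N K) k U₀)
    (hΔ₁ : ∀ x, Δ₁ (starW (phiRec N) x) = starW (phiRec N) (Δ₁ x)) (hQ : Function.Surjective (QOfRecord F N k U₀))
    (B : NegSize (F.L : ℝ) ((F.P K).eta k) levB 0 (Matrix (Fin N) (Fin N) ℂ)) (b : Bond (F.P K).d (fun _ => (F.P K).sitesPerDir 0)) :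
    JetSup.equiv _ _ (nabla115 ((F.P K).eta k) (unitsOfRecord F N U₀))
        (H1OfRecordAt F N K k Ω U₀ levB Δ₁ (QOfRecord F N k U₀) (QflatOfRecord F N k) a hpos hQ
          ((NegSup.equiv _ _).symm (star (NegSup.equiv _ _ B)))) b =
      star (JetSup.equiv _ _ (nabla115 ((F.P K).eta k) (unitsOfRecord F N U₀))
        (H1OfRecordAt F N K k Ω U₀ levB Δ₁ (QOfRecord F N k U₀) (QflatOfRecord F N k) a hpos hQ B) b) := by
  unfold H1OfRecordAt H1LatticeCLM
  rw [H1CLM_apply, H1CLM_apply, Equiv.apply_symm_apply, funEquiv_symm_star, H1LatticeK_ofRecord_starW F N k U₀ hpos h hΔ₁ hQ, apply_equiv_starW]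

/-- ★★★ **SECT. C's `H♭ = H1OfRecordAtBgFlat` (bare slot `Δ₁ := Δ(U₀)`, the `H` of def-Y's `WOfRecordAt` and of (3.134)) IS REAL** at every guarded background:
`(H♭ Bᴴ)(b) = ((H♭ B)(b))ᴴ`. [cite: Balaban1985Variational, (45)–(47) p.285, (103) p.293; Balaban1985BackgroundPropagators, (3.126) p.421, (3.134) p.422] -/
theorem equiv_H1OfRecordAtBgFlat_star (levB : PBond (F.P K) k → ℕ) (h : SmallBelow (avOfRecord F N K) k U₀) {a : ℝ}
    (hposb : ∀ x, x ≠ 0 → 0 < RCLike.re ⟪x, laplaceAOfRecord F N k U₀ (QOfRecord F N k U₀) (QflatOfRecord F N k) a x⟫_ℂ)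
    (hQ : Function.Surjective (QOfRecord F N k U₀))
    (B : NegSize (F.L : ℝ) ((F.P K).eta k) levB 0 (Matrix (Fin N) (Fin N) ℂ)) (b : Bond (F.P K).d (fun _ => (F.P K).sitesPerDir 0)) :
    JetSup.equiv _ _ (nabla115 ((F.P K).eta k) (unitsOfRecord F N U₀))
        (H1OfRecordAtBgFlat F N K k Ω U₀ levB a hposb hQ ((NegSup.equiv _ _).symm (star (NegSup.equiv _ _ B)))) b =
      star (JetSup.equiv _ _ (nabla115 ((F.P K).eta k) (unitsOfRecord F N U₀)) (H1OfRecordAtBgFlat F N K k Ω U₀ levB a hposb hQ B) b) :=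
  equiv_H1OfRecordAt_star F N k U₀ Ω hposb levB h (hessOpOfRecord_starW F N k U₀) hQ B b

end Reading

end Summit.QuantumFields.YangMills.Theorems.N07H1OfRecordReality

end
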